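import Mathlib.RingTheory.Smooth.Locus
import Mathlib.RingTheory.RegularLocalRing.Defs
import Mathlib.RingTheory.Localization.Away.Basic
import Mathlib.RingTheory.Valuation.ValuationSubring
import Literature.AlgebraicGeometry.Resolution.SmoothOfRegularFibre
import HarnessLib

/-!
# A regular centre has a smooth basic open neighbourhood inside the valuation ring
# (crux `IndSmooth.ValuativeSmoothing`, line `birth`, stub `stub_smoothNbhd`)

Stub `stub_smoothNbhd` of the skeleton `Lines/birth.lean` (lead reshape r2) for crux
stmt-ResolutionOfSingularities-16087. Over a PERFECT field `k`, let `(L, O')` be a valued field and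
`N ⊆ O'` a finitely generated `k`-subalgebra which is regular at the centre
`𝔭 := 𝔪_{O'} ∩ N` of the valuation ring on it. Then `N` is contained in a finitely generated SMOOTH
`k`-subalgebra `N' ⊆ O'` of `L`, namely the basic open neighbourhood `N' = N[f⁻¹]` of the centre
for a suitable `f ∈ N ∖ 𝔭`.

Proof. `N` is of finite type over the field `k`, hence finitely presented; regular at `𝔭` over a
perfect field means smooth at `𝔭`
(`Literature.AlgebraicGeometry.Resolution.isSmoothAt_iff_isRegularLocalRing_of_perfectField`,
Stacks 00TV / Matsumura §30 Remark 2), and the smooth locus of a finitely presented algebra is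
open, so some `f ∉ 𝔭` has `N_f` smooth over `k` (`Algebra.IsSmoothAt.exists_notMem_smooth`). As
`f ∉ 𝔪_{O'}`, `f` is a unit of `O'`, so the inclusion `N → O'` extends to `N_f → O' ⊆ L`; this map
is injective (`N` is a domain and `f ≠ 0`), and its range `N' = N[f⁻¹]` is the required
subalgebra: it lies in `O'`, contains `N`, is `k`-isomorphic to the smooth `N_f`, and is finitely
generated (smooth algebras are finitely presented).
-/

-- single-problem summit: the doubled namespace component is forced
set_option linter.dupNamespace false

namespace Summit.ResolutionOfSingularities.ResolutionOfSingularities.Theorems.ValuativeSmoothing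

open IsLocalRing

/-- **Stub `stub_smoothNbhd` (line `birth`, crux `IndSmooth.ValuativeSmoothing`): a regular
centre has a smooth basic open neighbourhood inside the valuation ring.** Over a perfect field
`k`, a finitely generated `k`-subalgebra `N` of a valued field `(L, O')` with `N ⊆ O'`, whose
localization at the centre `𝔪_{O'} ∩ N` is a regular local ring, is contained in a finitely
generated smooth `k`-subalgebra `N' ⊆ O'` of `L` (namely `N' = N[f⁻¹]` for some `f ∈ N` outside
the centre with `N_f` smooth: regular ⇒ smooth at the centre over a perfect field, and the smooth
locus is open). [cite: Matsumura1987, §30 Remark 2 after Thm. 30.3] -/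
theorem stub_smoothNbhd (k L : Type) [Field k] [PerfectField k] [Field L] [Algebra k L]
    (O' : ValuationSubring L) (N : Subalgebra k L) (hN : N.toSubring ≤ O'.toSubring) (hNfg : N.FG)
    (hreg : IsRegularLocalRing (Localization.AtPrime
      (Ideal.comap (Subring.inclusion hN) (IsLocalRing.maximalIdeal O')))) :
    ∃ N' : Subalgebra k L, N'.toSubring ≤ O'.toSubring ∧ N'.FG ∧ Algebra.Smooth k N' ∧ N ≤ N' := by
  -- the centre `𝔭 = 𝔪_{O'} ∩ N`
  set p : Ideal N := Ideal.comap (Subring.inclusion hN) (maximalIdeal O') with hp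
  haveI : Algebra.FiniteType k N := N.fg_iff_finiteType.mp hNfg
  haveI : Algebra.FinitePresentation k N := (Algebra.FinitePresentation.of_finiteType).mp ‹_›
  -- regular at `𝔭` over a perfect field ⇒ smooth at `𝔭` (Stacks 00TV)
  haveI hsm : Algebra.IsSmoothAt k p :=
    (Literature.AlgebraicGeometry.Resolution.isSmoothAt_iff_isRegularLocalRing_of_perfectField
      k N p).mpr hreg
  -- the smooth locus is open: a basic open neighbourhood `D(f) ∋ 𝔭` with `N_f` smooth
  obtain ⟨f, hfp, hfsm⟩ := Algebra.IsSmoothAt.exists_notMem_smooth k p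
  -- `f ∉ 𝔪_{O'}` is a unit of `O'`, so `f ≠ 0` and `f⁻¹ ∈ O'`
  have hfu : IsUnit (Subring.inclusion hN f) := by
    by_contra h
    exact hfp (Ideal.mem_comap.mpr ((mem_maximalIdeal _).mpr (mem_nonunits_iff.mpr h)))
  have hf0N : f ≠ 0 := by
    rintro rfl
    exact hfp p.zero_mem
  have hf0 : (f : L) ≠ 0 := by exact_mod_cast hf0N
  have hfinv : (f : L)⁻¹ ∈ O' := by
    obtain ⟨b, hb⟩ := hfu.exists_right_inv
    have h1 : (f : L) * (b : L) = 1 := by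
      have := congrArg (fun z : O'.toSubring => (z : L)) hb
      simpa using this
    rw [inv_eq_of_mul_eq_one_right h1]
    exact b.2
  -- `O'` as a `k`-subalgebra of `L` (it contains `N ∋ algebraMap k L c`)
  let O'k : Subalgebra k L :=
    { O'.toSubring with
      algebraMap_mem' := fun c => hN (N.algebraMap_mem c) }
  have hNO : N ≤ O'k := fun x hx => hN hx
  -- the inclusion `ι : N → O'` inverts `f`, hence extends to `ψ : N_f → O'`
  let ι : N →ₐ[k] O'k := Subalgebra.inclusion hNO
  have hιf : IsUnit (ι f) :=
    isUnit_iff_exists_inv.mpr ⟨⟨(f : L)⁻¹, hfinv⟩, Subtype.ext (by simp [ι, hf0])⟩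
  have hι : ∀ y : Submonoid.powers f, IsUnit (ι y) := by
    rintro ⟨y, m, rfl⟩
    rw [map_pow]
    exact hιf.pow m
  let ψ : Localization.Away f →ₐ[k] O'k := IsLocalization.liftAlgHom (M := Submonoid.powers f) hι
  -- `ψ` is injective: `N → N_f` is injective (`N` is a domain, `f ≠ 0`) and so is `ι`
  have hle : Submonoid.powers f ≤ nonZeroDivisors N :=
    powers_le_nonZeroDivisors_of_noZeroDivisors hf0N
  have hψ : Function.Injective ψ :=
    (IsLocalization.lift_injective_iff (S := Localization.Away f) hι).mpr fun x y =>
      ⟨fun h => congrArg _ (IsLocalization.injective (Localization.Away f) hle h),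
        fun h => congrArg _ (Subalgebra.inclusion_injective hNO h)⟩
  -- `φ : N_f ↪ L`; its range `N' = N[f⁻¹]` is `k`-isomorphic to the smooth `N_f`
  let φ : Localization.Away f →ₐ[k] L := O'k.val.comp ψ
  have hφ : Function.Injective φ := Subtype.val_injective.comp hψ
  let e : Localization.Away f ≃ₐ[k] φ.range := AlgEquiv.ofInjective φ hφ
  haveI := hfsm
  haveI hS : Algebra.Smooth k φ.range := Algebra.Smooth.of_equiv e
  haveI : Algebra.FinitePresentation k φ.range := Algebra.Smooth.finitePresentation
  refine ⟨φ.range, ?_, φ.range.fg_iff_finiteType.mpr inferInstance, hS, ?_⟩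
  · -- `N' ⊆ O'`: `φ` factors through `ψ : N_f → O'`
    intro x hx
    obtain ⟨z, rfl⟩ := (AlgHom.mem_range φ).mp (Subalgebra.mem_toSubring.mp hx)
    exact (ψ z).2
  · -- `N ⊆ N'`: `φ (x / 1) = x`
    intro x hx
    refine (AlgHom.mem_range φ).mpr ⟨algebraMap N (Localization.Away f) ⟨x, hx⟩, ?_⟩
    show ((IsLocalization.lift hι (algebraMap N (Localization.Away f) ⟨x, hx⟩) : O'k) : L) = x
    rw [IsLocalization.lift_eq]
    rfl

end Summit.ResolutionOfSingularities.ResolutionOfSingularities.Theorems.ValuativeSmoothing
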